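import Mathlib.LinearAlgebra.Span.Basic
import Mathlib.Algebra.Module.Submodule.Map
import Mathlib.Algebra.Module.Submodule.Ker
import Mathlib.Algebra.Module.Submodule.Range
import Mathlib.LinearAlgebra.Matrix.ToLin
import Mathlib.Data.Matrix.Basic
import HarnessLib

/-!
# The algebra of Lemma L1: an operator supported on the old part factors through the degeneracy map, and its adjoint action lands in `range (i† ∘ i)` (cell `b2b-bsdres`, seat additive-p4 gen 37, line V58/V64 — the `i†i = u` argument)

HONEST FRAMING (verbatim, cell `b2b-bsdres`): the goal of the cell is to DELETE the COMBINATION-SHAPED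
residual classes for ALL analytic-rank `≤ 1` curves over `ℚ` — "full BSD formula for every rank `≤ 1`
curve in class `C`" assembled STRICTLY from published theorems — so that the rank-`≤ 1` remainder
becomes exactly the CONSTRUCTION-SHAPED classes, which are TYPED (missing-input Props), NOT attempted;
this is not "finishing BSD". This file: TOOL theorems (pure module / matrix algebra; 0 defs, 0 facts,
nothing booked; X4 stays CONSTRUCTION-SHAPED; no mark moves).

## Why

Proposition V58 (memo V58 §3–§5; consumed again by memo V64's Prop. V64-D for the σ(θ)-forms on the
definite quaternion algebra) derives the KEY IDENTITY (K) — "a Hecke operator on the Brandt module that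
kills the `ℓ₁`-new forms acts on the `ℓ₁`-old forms as a multiple of `η = U² − 1`" — from Lemma L1:
with `i : H² → H′` the `ℓ₁`-degeneracy map (injective, SATURATED image = Ihara), `i†` its adjoint for
the perfect pairings (SURJECTIVE), `u = i† ∘ i`, and `t` an operator on `H′` with `tH′ ⊆ i(H²)`
(supported on the old part): `t = i ∘ φ`, `i† t = u φ`, and adjunction `i† t = t^{(2)τ} i†` give
`t^{(2)τ} H² ⊆ u H²`, whence (multiplicity one: `H ≅ R`) `t^{(2)} ∈ M₂(R)·u`, and L2 (`X4/…`, K104)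
turns `M₂(R)·u ∩ R[𝒰]` into `(𝒰² − 1)`. This file proves the two algebraic steps with every
analytic input displayed as a hypothesis:

* `range_le_range_comp_of_range_le` : modules `P, H′`, maps `i : P → H′` (injective), `j : H′ → P`
  (surjective), an operator `t` on `H′` with `range t ≤ range i`, and an operator `s` on `P` with
  `j ∘ t = s ∘ j` (the adjoint action). Then `range s ≤ range (j ∘ i)`.
* `Matrix.exists_mul_eq_of_range_toLin'_le` : for square matrices `S, U` over a commutative ring with
  `range S ≤ range U` (as endomorphisms of `n → R`), there is a matrix `C` with `S = U * C` — the
  "`H` free of rank one" step that turns the inclusion of ranges into divisibility in `M₂(R)`.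

No number theory enters; Ihara (injectivity + saturation), the perfect pairings (surjectivity of the
adjoint, the adjunction formula) and multiplicity one (freeness) are the APPLICATION's inputs — exactly
the inputs that instruments E13–E15 / E17 / E17b / E17c measure at the rows.

## References (context only; the proofs are elementary)

* K. Ribet, Invent. Math. 100 (1990), §§3, 6 (the degeneracy maps on the character group, `σδ = η`).
  [cite: Ribet1990, §3, (6.1)]
* H. Darmon, F. Diamond, R. Taylor, Fermat's last theorem (1995), Lemma 4.28 (the congruence-module
  / `Ann(ker) ↦ (η)` bookkeeping). [cite: DarmonDiamondTaylor1995, Lemma 4.28]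
-/

namespace Summit.BirchSwinnertonDyer.Rank1Residual.LevelLowering

section L1

variable {R P H' : Type*} [CommRing R] [AddCommGroup P] [Module R P] [AddCommGroup H'] [Module R H']

/-- **L1, module form.** `i : P → H′` ("degeneracy map"; injectivity is not even needed for this
inclusion), `j : H′ → P` surjective ("its adjoint"), `t : H′ → H′` with `range t ≤ range i` ("`t` is supported on the old part", using the
saturation of `i(P)`), and `s : P → P` with `j ∘ t = s ∘ j` ("the adjoint action of `t` on the old
pair"). Then `range s ≤ range (j ∘ i)` — i.e. `t^{(2)τ} H² ⊆ u H²` with `u = i† i`.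
[cite: Ribet1990, §3, (6.1)] -/
theorem range_le_range_comp_of_range_le (i : P →ₗ[R] H') (j : H' →ₗ[R] P) (t : H' →ₗ[R] H')
    (s : P →ₗ[R] P) (hj : Function.Surjective j)
    (ht : LinearMap.range t ≤ LinearMap.range i) (hadj : j ∘ₗ t = s ∘ₗ j) :
    LinearMap.range s ≤ LinearMap.range (j ∘ₗ i) := by
  rintro y ⟨x, rfl⟩
  obtain ⟨h, rfl⟩ := hj x
  -- `t h ∈ range i`: write `t h = i p`
  obtain ⟨p, hp⟩ : t h ∈ LinearMap.range i := ht (LinearMap.mem_range_self t h)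
  refine ⟨p, ?_⟩
  have e : s (j h) = j (t h) := by
    have := LinearMap.congr_fun hadj h
    simpa using this.symm
  rw [LinearMap.comp_apply, hp, e]

/-- Variant with the factorisation made explicit: under the same hypotheses there is a (unique) linear
`φ : H′ → P` with `t = i ∘ φ`, and then `s ∘ j = (j ∘ i) ∘ φ`. -/
theorem exists_factor_and_adjoint_eq (i : P →ₗ[R] H') (j : H' →ₗ[R] P) (t : H' →ₗ[R] H')
    (s : P →ₗ[R] P) (hi : Function.Injective i)
    (ht : LinearMap.range t ≤ LinearMap.range i) (hadj : j ∘ₗ t = s ∘ₗ j) :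
    ∃ φ : H' →ₗ[R] P, t = i ∘ₗ φ ∧ s ∘ₗ j = (j ∘ₗ i) ∘ₗ φ := by
  -- φ := (i restricted to its range)⁻¹ ∘ (t co-restricted to range i)
  let e : P ≃ₗ[R] LinearMap.range i := LinearEquiv.ofInjective i hi
  let tc : H' →ₗ[R] LinearMap.range i := LinearMap.codRestrict (LinearMap.range i) t (fun h => ht (LinearMap.mem_range_self t h))
  refine ⟨e.symm.toLinearMap ∘ₗ tc, ?_, ?_⟩
  · ext h
    have h1 : (i (e.symm (tc h)) : H') = (e (e.symm (tc h)) : H') := by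
      rfl
    simp only [LinearMap.comp_apply, LinearEquiv.coe_coe]
    rw [h1, LinearEquiv.apply_symm_apply]
    rfl
  · ext h
    have := LinearMap.congr_fun hadj h
    simp only [LinearMap.comp_apply, LinearEquiv.coe_coe] at this ⊢
    rw [← this]
    congr 1
    have h1 : (i (e.symm (tc h)) : H') = (e (e.symm (tc h)) : H') := rfl
    rw [h1, LinearEquiv.apply_symm_apply]
    rfl

end L1

section MatrixStep

variable {R : Type*} [CommRing R] {n : Type*} [Fintype n] [DecidableEq n]

/-- **The "free of rank one" step of L1.** If the column space of `S` is contained in that of `U`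
(`range (S.toLin') ≤ range (U.toLin')` on `n → R`), then `S = U * C` for some matrix `C`: the
inclusion of ranges is divisibility in the matrix ring. (In the application `n = Fin 2`, `U = i†i =
[[ℓ+1, T_ℓ],[T_ℓ, ℓ+1]]`, and L2 = K104 then identifies `M₂(R)·U ∩ R[𝒰]` with `(𝒰² − 1)`.)
[cite: DarmonDiamondTaylor1995, Lemma 4.28] -/
theorem Matrix.exists_mul_eq_of_range_toLin'_le (S U : Matrix n n R)
    (h : LinearMap.range (Matrix.toLin' S) ≤ LinearMap.range (Matrix.toLin' U)) :
    ∃ C : Matrix n n R, S = U * C := by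
  -- each column of S lies in the column space of U
  have hcol : ∀ k : n, ∃ c : n → R, U.mulVec c = fun r => S r k := by
    intro k
    have : (fun r => S r k) ∈ LinearMap.range (Matrix.toLin' S) := by
      refine ⟨Pi.single k 1, ?_⟩
      ext r
      simp [Matrix.toLin'_apply, Matrix.mulVec, dotProduct, Pi.single_apply]
    obtain ⟨c, hc⟩ := h this
    exact ⟨c, by simpa [Matrix.toLin'_apply] using hc⟩
  choose c hc using hcol
  refine ⟨Matrix.of fun r k => c k r, ?_⟩
  ext r k
  have := congr_fun (hc k) r
  simp only [Matrix.mul_apply, Matrix.of_apply]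
  rw [← this]
  simp [Matrix.mulVec, dotProduct]

end MatrixStep

end Summit.BirchSwinnertonDyer.Rank1Residual.LevelLowering
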